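import Mathlib
import HarnessLib
import Summits.NavierStokesRegularity.NavierStokesRegularity.Theorems.PoloidalWindowDoorLrcModEntireRidgeWebLaw
import Summits.NavierStokesRegularity.NavierStokesRegularity.Theorems.PoloidalWindowDoorPoloidalWindowRigidityTimeHeightShearLinearSlice
import Summits.NavierStokesRegularity.NavierStokesRegularity.Theorems.PoloidalWindowDoorPoloidalWindowRigidityConstantShearSlice

/-!
# Item `LrcModEntire` (stmt-NavierStokesRegularity-20428) — THE HORIZONTAL RIDGE LAW ON EVERY WEB CURVE: the transversal curvature `κ(t,z)` of `Γ_{t,z}` is constant along it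

ns-k2-port-2 g6 (helper prover under the LEAD of item 20428, ns-poloidal-K2-p3 g15; `--supports stmt-NavierStokesRegularity-20428 --as helper`).
`…RidgeWebLaw.laplacian_two_eq_of_webFermat` (p714834) gives ONE value of the full Laplacian `ΔU₂(t,·)` along a web curve of the homogeneous web; with the plane wave
identity of the (TH) column `∂₂²U₂ = −μ(t,z)ΔₕU₂` on the plane `{y₂ = z}` (`…TimeHeightShearLinearSlice.plane_wave_identity`, slope form on the whole plane — supplied for the
hull element on the uniform slab by `…TwistingTHSlopeSlab` / `…RidgeWebTH`) and `μ(t,z) ≠ 1`, the HORIZONTAL Laplacian `∂₀²U₂ + ∂₁²U₂` takes one value too.  Since the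
web-curve tangent is a null direction of the Hessian (`…RidgeWebCurves.hessian_webCurve_tangent_eq_zero`), this value is (minus) the transversal curvature `κ(t,z)` of
`Γ_{t,z}` — memo `Cruxes/LrcModEntire/T2B-g14.md` §10 «`Δₕv₂|_{Γ_{t,z}} = −κ(t,z)`» BY NAME.

* `laplacian_two_split_at` — `Δ(v₂(t,·)) = (∂₀² + ∂₁²)v₂ + ∂₂²v₂` in coordinate-nested form, any slice `t < 0` (the `t = −1` case is `…TwistingTHRidgeLaw.laplacian_two_split`);
* `horizLaplacian_two_eq_of_webFermat` — the statement above.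

WHAT THIS IS NOT: not a claim about Navier–Stokes regularity — a structural law of the hypothetical homogeneous null ridge of the research cell (Q4) (bears_on LADDER-NS N0,
item 20428 / crux 19708; 20428/19708/27893 OPEN; (Q4) OPEN).  No summit statement is proved here.
-/

noncomputable section

-- the summit and its single sub-problem share the name (CONVENTIONS §1), as in every Theorems file
set_option linter.dupNamespace false

namespace Summit.NavierStokesRegularity.NavierStokesRegularity.Theorems.PoloidalWindowDoorLrcModEntireRidgeWebLawHoriz

open MeasureTheory Set Function Filter Topology Metric
open scoped RealInnerProductSpace InnerProductSpace Laplacian ContDiff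
open Literature.Analysis Literature.Analysis.FluidPDE Literature.Analysis.UnboundedOperators
open Summit.NavierStokesRegularity.NavierStokesRegularity.Theorems
open Summit.NavierStokesRegularity.NavierStokesRegularity.Theorems.PoloidalWindowDoorLrcModEntireRidgeWebLaw
open Summit.NavierStokesRegularity.NavierStokesRegularity.Theorems.PoloidalWindowDoorLrcModEntireRidgeClassConstants
open Summit.NavierStokesRegularity.NavierStokesRegularity.Theorems.PoloidalWindowDoorPoloidalWindowRigidityTimeHeightShearLinearSlice
open Summit.NavierStokesRegularity.NavierStokesRegularity.Theorems.PoloidalWindowDoorPoloidalWindowRigidityConstantShearSlice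

variable {C : ℝ} {v : ℝ → EuclideanSpace ℝ (Fin 3) → EuclideanSpace ℝ (Fin 3)}


/-- The Laplacian of `v₂(t,·)` splits into the horizontal part and `∂₂²` (any slice `t < 0`). -/
theorem laplacian_two_split_at (hrate : HasTypeITimeDecay C v)
    (hcont : ContinuousOn (uncurry v) (Iio (0 : ℝ) ×ˢ univ))
    (hmild : ∀ s t : ℝ, s < t → t < 0 → ∀ x, v t x = heatExtension (v s) (t - s) x - oseenDuhamel 1 s v v t x)
    (hdiv : ∀ t < 0, VectorCalculus.IsDivFree (v t)) {t : ℝ} (ht : t < 0) (y : EuclideanSpace ℝ (Fin 3)) :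
    (Δ (fun w => v t w 2)) y =
      (fderiv ℝ (fun w => fderiv ℝ (fun y' => v t y' 2) w (EuclideanSpace.single 0 (1 : ℝ))) y (EuclideanSpace.single 0 (1 : ℝ)) +
        fderiv ℝ (fun w => fderiv ℝ (fun y' => v t y' 2) w (EuclideanSpace.single 1 (1 : ℝ))) y (EuclideanSpace.single 1 (1 : ℝ))) +
      fderiv ℝ (fun w => fderiv ℝ (fun y' => v t y' 2) w (EuclideanSpace.single 2 (1 : ℝ))) y (EuclideanSpace.single 2 (1 : ℝ)) := by
  have hθ : ContDiff ℝ 2 (fun w : EuclideanSpace ℝ (Fin 3) => v t w 2) :=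
    (contDiff_piLp_apply (p := 2) (𝕜 := ℝ) (E := fun _ : Fin 3 => ℝ) (i := (2 : Fin 3))).comp
      (PoloidalWindowDoorLrcModEntireRidgeClassConstants.contDiff_slice_of_class hrate hcont hmild hdiv ht)
  have hΔ := congrFun (InnerProductSpace.laplacian_eq_iteratedFDeriv_orthonormalBasis (fun w : EuclideanSpace ℝ (Fin 3) => v t w 2)
    (EuclideanSpace.basisFun (Fin 3) ℝ)) y
  simp only [EuclideanSpace.basisFun_apply] at hΔ
  rw [hΔ, Fin.sum_univ_three]
  have e : ∀ i : Fin 3, iteratedFDeriv ℝ 2 (fun w : EuclideanSpace ℝ (Fin 3) => v t w 2) y ![EuclideanSpace.single i (1 : ℝ), EuclideanSpace.single i (1 : ℝ)] =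
      fderiv ℝ (fun w => fderiv ℝ (fun y' => v t y' 2) w (EuclideanSpace.single i (1 : ℝ))) y (EuclideanSpace.single i (1 : ℝ)) := by
    intro i
    rw [iteratedFDeriv_two_apply]
    simp only [Matrix.cons_val_zero, Matrix.cons_val_one]
    have hd : Differentiable ℝ (fderiv ℝ (fun y' : EuclideanSpace ℝ (Fin 3) => v t y' 2)) :=
      (hθ.fderiv_right (m := 1) (by norm_cast)).differentiable (by simp)
    rw [fderiv_clm_apply (hd y) (differentiableAt_const _)]
    simp
  rw [e 0, e 1, e 2]

/-- **THE HORIZONTAL RIDGE LAW ON EVERY WEB CURVE.**  As in `laplacian_two_eq_of_webFermat`, plus the slope form ON THE WHOLE PLANE `{y₂ = p₂}` at time `−1+τ₀` with the constant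
slope `μ(−1+τ₀, p₂)` (what `…TwistingTHSlopeSlab.slopeForm_hullLimit_slab` / `…RidgeWebTH.exists_hullLimit_ridgeWebTH` supply for the hull element on the slab): the HORIZONTAL
Laplacian `∂₀²U₂ + ∂₁²U₂` takes ONE value at the two web points (plane wave identity `∂₂²U₂ = −μΔₕU₂`, `…TimeHeightShearLinearSlice.plane_wave_identity`) — the
transversal curvature `κ(τ₀, z₀)` of the web curve `Γ_{τ₀,z₀}` (its tangent is a null direction, `…RidgeWebCurves.hessian_webCurve_tangent_eq_zero`). -/
theorem horizLaplacian_two_eq_of_webFermat (hrate : HasTypeITimeDecay C v)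
    (hcont : ContinuousOn (uncurry v) (Iio (0 : ℝ) ×ˢ univ))
    (hmild : ∀ s t : ℝ, s < t → t < 0 → ∀ x, v t x = heatExtension (v s) (t - s) x - oseenDuhamel 1 s v v t x)
    (hdiv : ∀ t < 0, VectorCalculus.IsDivFree (v t))
    (hpol : ∀ s < 0, ∀ y, ⟪curl (v s) y, EuclideanSpace.single 2 1⟫_ℝ = 0)
    {μ : ℝ → ℝ → ℝ} (hμ : ContDiff ℝ 3 (uncurry μ)) {τ₀ : ℝ} (hτ₀ : |τ₀| < 1 / 2)
    {p p' : EuclideanSpace ℝ (Fin 3)} (hpp' : p 2 = p' 2)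
    (hslope : ∀ y : EuclideanSpace ℝ (Fin 3), y 2 = p 2 →
      ∀ᶠ z in 𝓝 ((-1 + τ₀, y) : ℝ × EuclideanSpace ℝ (Fin 3)), ∀ b : Fin 3, b ≠ 2 →
        fderiv ℝ (v z.1) z.2 (EuclideanSpace.single 2 1) b = μ z.1 (z.2 2) * fderiv ℝ (v z.1) z.2 (EuclideanSpace.single b 1) 2)
    (hplaneSlope : ∀ y : EuclideanSpace ℝ (Fin 3), y 2 = p 2 → ∀ b : Fin 3, b ≠ 2 →
      fderiv ℝ (v (-1 + τ₀)) y (EuclideanSpace.single 2 1) b = μ (-1 + τ₀) (p 2) * fderiv ℝ (v (-1 + τ₀)) y (EuclideanSpace.single b 1) 2)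
    (hμ1 : μ (-1 + τ₀) (p 2) ≠ 1) {σ : ℝ} (hσ : σ = 1 ∨ σ = -1) {A : ℝ × ℝ →L[ℝ] ℝ}
    (hp : fderiv ℝ (uncurry fun τ y => σ * v (-1 + τ) y 2) (τ₀, p) =
      A.comp ((ContinuousLinearMap.fst ℝ ℝ (EuclideanSpace ℝ (Fin 3))).prod
        ((EuclideanSpace.proj (2 : Fin 3)).comp (ContinuousLinearMap.snd ℝ ℝ (EuclideanSpace ℝ (Fin 3))))))
    (hp' : fderiv ℝ (uncurry fun τ y => σ * v (-1 + τ) y 2) (τ₀, p') =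
      A.comp ((ContinuousLinearMap.fst ℝ ℝ (EuclideanSpace ℝ (Fin 3))).prod
        ((EuclideanSpace.proj (2 : Fin 3)).comp (ContinuousLinearMap.snd ℝ ℝ (EuclideanSpace ℝ (Fin 3))))))
    (hval : σ * v (-1 + τ₀) p 2 = σ * v (-1 + τ₀) p' 2) :
    fderiv ℝ (fun w => fderiv ℝ (fun y' => v (-1 + τ₀) y' 2) w (EuclideanSpace.single 0 (1 : ℝ))) p (EuclideanSpace.single 0 (1 : ℝ)) +
        fderiv ℝ (fun w => fderiv ℝ (fun y' => v (-1 + τ₀) y' 2) w (EuclideanSpace.single 1 (1 : ℝ))) p (EuclideanSpace.single 1 (1 : ℝ)) =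
      fderiv ℝ (fun w => fderiv ℝ (fun y' => v (-1 + τ₀) y' 2) w (EuclideanSpace.single 0 (1 : ℝ))) p' (EuclideanSpace.single 0 (1 : ℝ)) +
        fderiv ℝ (fun w => fderiv ℝ (fun y' => v (-1 + τ₀) y' 2) w (EuclideanSpace.single 1 (1 : ℝ))) p' (EuclideanSpace.single 1 (1 : ℝ)) := by
  have ht : -1 + τ₀ < 0 := by linarith [(abs_lt.1 hτ₀).2]
  have hL := laplacian_two_eq_of_webFermat hrate hcont hmild hdiv hpol hμ hτ₀ hpp' hslope hμ1 hσ hp hp' hval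
  have hu : ContDiff ℝ 2 (v (-1 + τ₀)) := PoloidalWindowDoorLrcModEntireRidgeClassConstants.contDiff_slice_of_class hrate hcont hmild hdiv ht
  have hw := fun (x : EuclideanSpace ℝ (Fin 3)) (hx : x 2 = p 2) =>
    plane_wave_identity hu (fun x => div_coord (hdiv (-1 + τ₀) ht) x) hplaneSlope hx
  rw [laplacian_two_split_at hrate hcont hmild hdiv ht p, laplacian_two_split_at hrate hcont hmild hdiv ht p', hw p rfl, hw p' hpp'.symm] at hL
  have hρ : (1 - μ (-1 + τ₀) (p 2)) ≠ 0 := sub_ne_zero.2 (Ne.symm hμ1)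
  set a := fderiv ℝ (fun w => fderiv ℝ (fun y' => v (-1 + τ₀) y' 2) w (EuclideanSpace.single 0 (1 : ℝ))) p (EuclideanSpace.single 0 (1 : ℝ)) +
        fderiv ℝ (fun w => fderiv ℝ (fun y' => v (-1 + τ₀) y' 2) w (EuclideanSpace.single 1 (1 : ℝ))) p (EuclideanSpace.single 1 (1 : ℝ)) with ha
  set b := fderiv ℝ (fun w => fderiv ℝ (fun y' => v (-1 + τ₀) y' 2) w (EuclideanSpace.single 0 (1 : ℝ))) p' (EuclideanSpace.single 0 (1 : ℝ)) +
        fderiv ℝ (fun w => fderiv ℝ (fun y' => v (-1 + τ₀) y' 2) w (EuclideanSpace.single 1 (1 : ℝ))) p' (EuclideanSpace.single 1 (1 : ℝ)) with hb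
  have h2 : (1 - μ (-1 + τ₀) (p 2)) * (a - b) = 0 := by linarith
  rcases mul_eq_zero.1 h2 with h | h
  · exact absurd h hρ
  · linarith

end Summit.NavierStokesRegularity.NavierStokesRegularity.Theorems.PoloidalWindowDoorLrcModEntireRidgeWebLawHoriz

end
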